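import Mathlib
import HarnessLib

/-!
# Zero-mode action floor — pointwise real algebra for the absorption step (lead c7, line
`zero-mode-floor-dilute-gas` of crux `NestedDissectionSea.EarlyCrosserLaw`, stmt-QuantumFields-13995)

Helpers for the registered stub `stub_floorAssembly`: Cauchy–Schwarz for the real pairing
`Re Σ conj(u) w` on `ℂ⁴ ⊗ ℂ³`, and the absorption inequality
`−2 χ Σ_μ a_μ V_μ ≤ δ χ² Σ_μ G_μ + δ⁻¹ (Σ_μ a_μ²) n` whenever `V_μ² ≤ n G_μ`.
-/

noncomputable section

open scoped BigOperators

namespace Summit.QuantumFields.QCD.Cruxes.EarlyCrosserLaw.ZeroModeFloorDiluteGas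

/-- Cauchy–Schwarz for the real pairing on `ℂ⁴ ⊗ ℂ³`: `(Re Σ conj(u) w)² ≤ (Σ‖u‖²)(Σ‖w‖²)`. -/
theorem re_inner_sq_le (u w : Fin 4 → Fin 3 → ℂ) :
    (∑ s, ∑ c, starRingEnd ℂ (u s c) * w s c).re ^ 2 ≤ (∑ s, ∑ c, ‖u s c‖ ^ 2) * ∑ s, ∑ c, ‖w s c‖ ^ 2 := by
  have h1 : |(∑ s, ∑ c, starRingEnd ℂ (u s c) * w s c).re| ≤ ∑ s, ∑ c, ‖u s c‖ * ‖w s c‖ := by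
    refine (Complex.abs_re_le_norm _).trans ?_
    refine (norm_sum_le _ _).trans (Finset.sum_le_sum fun s _ => ?_)
    refine (norm_sum_le _ _).trans (Finset.sum_le_sum fun c _ => ?_)
    rw [norm_mul, RCLike.norm_conj]
  -- flatten the double sums to `Fin 4 × Fin 3`
  have e1 : ∑ s, ∑ c, ‖u s c‖ * ‖w s c‖ = ∑ p : Fin 4 × Fin 3, ‖u p.1 p.2‖ * ‖w p.1 p.2‖ :=
    (Fintype.sum_prod_type' fun s c => ‖u s c‖ * ‖w s c‖).symm
  have e2 : ∑ s, ∑ c, ‖u s c‖ ^ 2 = ∑ p : Fin 4 × Fin 3, ‖u p.1 p.2‖ ^ 2 :=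
    (Fintype.sum_prod_type' fun s c => ‖u s c‖ ^ 2).symm
  have e3 : ∑ s, ∑ c, ‖w s c‖ ^ 2 = ∑ p : Fin 4 × Fin 3, ‖w p.1 p.2‖ ^ 2 :=
    (Fintype.sum_prod_type' fun s c => ‖w s c‖ ^ 2).symm
  have hcs := Finset.sum_mul_sq_le_sq_mul_sq Finset.univ (fun p : Fin 4 × Fin 3 => ‖u p.1 p.2‖)
    (fun p => ‖w p.1 p.2‖)
  rw [e2, e3]
  calc (∑ s, ∑ c, starRingEnd ℂ (u s c) * w s c).re ^ 2
      = |(∑ s, ∑ c, starRingEnd ℂ (u s c) * w s c).re| ^ 2 := (sq_abs _).symm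
    _ ≤ (∑ s, ∑ c, ‖u s c‖ * ‖w s c‖) ^ 2 := pow_le_pow_left₀ (abs_nonneg _) h1 2
    _ = (∑ p : Fin 4 × Fin 3, ‖u p.1 p.2‖ * ‖w p.1 p.2‖) ^ 2 := by rw [e1]
    _ ≤ _ := hcs

/-- **Absorption.**  If `V_μ² ≤ n·G_μ` with `n, G_μ ≥ 0` and `δ > 0` then
`−2 χ Σ_μ a_μ V_μ ≤ δ χ² Σ_μ G_μ + δ⁻¹ (Σ_μ a_μ²) n`. -/
theorem absorb_pointwise (χ n δ : ℝ) (a V G : Fin 4 → ℝ) (hδ : 0 < δ) (hn : 0 ≤ n) (hG : ∀ μ, 0 ≤ G μ)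
    (hV : ∀ μ, V μ ^ 2 ≤ n * G μ) :
    -2 * (χ * ∑ μ, a μ * V μ) ≤ δ * (χ ^ 2 * ∑ μ, G μ) + δ⁻¹ * ((∑ μ, a μ ^ 2) * n) := by
  -- `|V_μ| ≤ √n √G_μ`
  have hVle : ∀ μ, |V μ| ≤ Real.sqrt n * Real.sqrt (G μ) := fun μ => by
    rw [← Real.sqrt_mul hn, ← Real.sqrt_sq_eq_abs]
    exact Real.sqrt_le_sqrt (hV μ)
  -- `|Σ a V| ≤ √n √(Σ a²) √(Σ G)`
  have hsum : |∑ μ, a μ * V μ| ≤ Real.sqrt n * (Real.sqrt (∑ μ, a μ ^ 2) * Real.sqrt (∑ μ, G μ)) := by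
    calc |∑ μ, a μ * V μ| ≤ ∑ μ, |a μ * V μ| := Finset.abs_sum_le_sum_abs _ _
      _ = ∑ μ, |a μ| * |V μ| := Finset.sum_congr rfl fun μ _ => abs_mul _ _
      _ ≤ ∑ μ, |a μ| * (Real.sqrt n * Real.sqrt (G μ)) :=
          Finset.sum_le_sum fun μ _ => mul_le_mul_of_nonneg_left (hVle μ) (abs_nonneg _)
      _ = Real.sqrt n * ∑ μ, |a μ| * Real.sqrt (G μ) := by
          rw [Finset.mul_sum]; exact Finset.sum_congr rfl fun μ _ => by ring
      _ ≤ Real.sqrt n * (Real.sqrt (∑ μ, |a μ| ^ 2) * Real.sqrt (∑ μ, Real.sqrt (G μ) ^ 2)) := by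
          refine mul_le_mul_of_nonneg_left ?_ (Real.sqrt_nonneg _)
          rw [← Real.sqrt_mul (Finset.sum_nonneg fun i _ => sq_nonneg _)]
          exact (le_abs_self _).trans (Real.abs_le_sqrt (Finset.sum_mul_sq_le_sq_mul_sq _ _ _))
      _ = Real.sqrt n * (Real.sqrt (∑ μ, a μ ^ 2) * Real.sqrt (∑ μ, G μ)) := by
          congr 2
          · exact congrArg _ (Finset.sum_congr rfl fun μ _ => sq_abs _)
          · exact congrArg _ (Finset.sum_congr rfl fun μ _ => Real.sq_sqrt (hG μ))
  -- AM–GM with weight `δ`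
  set P := |χ| * Real.sqrt (∑ μ, G μ) with hP
  set Q := Real.sqrt (∑ μ, a μ ^ 2) * Real.sqrt n with hQ
  have hPQ : 2 * (P * Q) ≤ δ * P ^ 2 + δ⁻¹ * Q ^ 2 := by
    have h := sq_nonneg (Real.sqrt δ * P - (Real.sqrt δ)⁻¹ * Q)
    have hsd : Real.sqrt δ ^ 2 = δ := Real.sq_sqrt hδ.le
    have hsd' : (Real.sqrt δ)⁻¹ ^ 2 = δ⁻¹ := by rw [inv_pow, hsd]
    have hmid : Real.sqrt δ * (Real.sqrt δ)⁻¹ = 1 := mul_inv_cancel₀ (Real.sqrt_pos.2 hδ).ne'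
    have key : (Real.sqrt δ * P - (Real.sqrt δ)⁻¹ * Q) ^ 2 =
        Real.sqrt δ ^ 2 * P ^ 2 + (Real.sqrt δ)⁻¹ ^ 2 * Q ^ 2 - 2 * (Real.sqrt δ * (Real.sqrt δ)⁻¹) * (P * Q) := by
      ring
    rw [hsd, hsd', hmid] at key
    linarith [h, key]
  have hP2 : P ^ 2 = χ ^ 2 * ∑ μ, G μ := by
    rw [hP, mul_pow, sq_abs, Real.sq_sqrt (Finset.sum_nonneg fun μ _ => hG μ)]
  have hQ2 : Q ^ 2 = (∑ μ, a μ ^ 2) * n := by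
    rw [hQ, mul_pow, Real.sq_sqrt (Finset.sum_nonneg fun μ _ => sq_nonneg _), Real.sq_sqrt hn]
  have hmain : |2 * (χ * ∑ μ, a μ * V μ)| ≤ 2 * (P * Q) := by
    rw [abs_mul, abs_mul, abs_two, hP, hQ]
    have := mul_le_mul_of_nonneg_left hsum (abs_nonneg χ)
    nlinarith [this, abs_nonneg χ, Real.sqrt_nonneg n, Real.sqrt_nonneg (∑ μ, a μ ^ 2),
      Real.sqrt_nonneg (∑ μ, G μ)]
  have := neg_abs_le (2 * (χ * ∑ μ, a μ * V μ))
  rw [hP2, hQ2] at hPQ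
  linarith

end Summit.QuantumFields.QCD.Cruxes.EarlyCrosserLaw.ZeroModeFloorDiluteGas

end
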